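import Summits.HodgeConjecture.CorCM.Census.CentralSquaresCompanion

/-!
# The square-central class, VIII: THE FOUR-TYPE LAW — `μ(G, c) = φ₂(G, c)` for a `2`-group with a four-type base block and an involutive swap

COR-CM (cell `pub-hodgecm2`), count-neutral kernel combinatorics by the binder seat b09 (gen 45; lane SQUARE-CENTRAL CLASS, part VIII — the abstract
capstone), assembling parts I–VII BY NAME: the strict cover-closure law (I), the residual closure of the four-type block (II), the transversal and pair
relations in the frame `(T₀; T₁, Q)` and its companion `(T₀; T̄₁, cQ)` (IV–VII).  Theorems only: no definition, no `decide`, no certificate, no named fact,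
no `sorry`.  HONEST FRAMING: `HC_CM` is NOT proved, here or anywhere in the tree; nothing here is a period or a headline.

**THE FOUR-TYPE LAW (`isLeast_card_gfaces_generate_four`).**  Let `G` be a finite `2`-group with a central involution `c ≠ 1`, and let `T₀`, `T₁` be CM
types such that: the base changes of `T₀` are exactly `T₀`, `T̄₀`, `T₁`, `T̄₁` (`hbase`); `|T₀| = 4m` with `m ≥ 3`; `𝓗 = T₀ ∖ T₁` has `2m` elements; some
`Q ∈ G` with `Q² = 1` moves `T₀` to `T₁` and its place permutation preserves `𝓗`; and `𝓗` and `T₀ ∩ T₁` each carry a transversal of that permutation of size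
`m`.  Then the least number of faces whose base changes, together with the pairs, generate the Hodge lattice is EXACTLY the coinvariant fibre:
**`μ(G, c) = φ₂(G, c)`**.  The rows `D₄ × E` (`E` elementary abelian of rank `≥ 2`, `c = (r², 0)`; Galois CM fields with group `D₄ × C₂ʳ` and
multiquadratic maximal real subfield) are the instance `T₀ = E ∪ uE ∪ vE ∪ uvE`, `Q = u` (part IX).

PROOF.  Take any strict lowering cover `S` of `T₀` (part I) and `L = ℤ⟨pairs⟩ + ℤ⟨base changes of S⟩`.  Parts VI/VII give `R(T)`, `Rᶜ(T')`,
`Y_s − Y_{σs}`, `Y_s + Y_{σs}` (`s ∈ 𝓗`), `Y'_a + Y'_{σa}`, `Y'_a − Y'_{σa}` (`a ∈ T₀ ∩ T₁`) in `L`, hence `2Y_s`, `2Y'_a ∈ L`; part II closes every residual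
Hodge vector up to `2`; part I concludes.

## References
* [Pohlmann1968] H. Pohlmann, Algebraic cycles on abelian varieties of complex multiplication type, Ann. of Math. 88 (1968), Thm 1.
* [Milne1999] J. S. Milne, Lefschetz motives and the Tate conjecture, Compositio Math. 117 (1999), Prop. 2.1, p. 54.
-/

namespace Summit.HodgeConjecture.CorCM.Census.CentralSquares

open Finset
open scoped symmDiff
open Summit.HodgeConjecture.CorCM.Prior.AllgGroup.RfwfAllgGroup
open Summit.HodgeConjecture.CorCM.Census.BlockParity
open Summit.HodgeConjecture.CorCM.Census.Coinvariant
open Summit.HodgeConjecture.CorCM.Census.TwistGeneration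
open Summit.HodgeConjecture.CorCM.Census.BaseBlock
open Summit.HodgeConjecture.CorCM.Census.CoverClosure

noncomputable section

variable {G : Type*} [Group G] [Fintype G] [DecidableEq G] (c : G)

section Frame

variable (hc2 : c * c = 1) (hcen : ∀ x : G, x * c = c * x) (T₀ T₁ : CMF G c)
variable (hbase : ∀ Q : G, rt c Q T₀ = T₀ ∨ rt c Q T₀ = rt c c T₀ ∨ rt c Q T₀ = T₁ ∨ rt c Q T₀ = rt c c T₁)
variable (m : ℕ) (hn : T₀.1.card = 4 * m) (hH : (T₀.1 \ T₁.1).card = 2 * m)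
variable (Q : G) (hQ : rt c Q T₀ = T₁) (hQQ : Q * Q = 1)
variable (hσH : ∀ t ∈ T₀.1, ∀ t' ∈ T₀.1, (t' = t * Q ∨ t' = c * (t * Q)) → (t ∈ T₀.1 \ T₁.1 ↔ t' ∈ T₀.1 \ T₁.1))
variable (L : Submodule ℤ (CMF G c →₀ ℤ)) (hLrt : ∀ (Q' : G) (y : CMF G c →₀ ℤ), y ∈ L → Finsupp.mapDomain (rt c Q') y ∈ L)
variable (hP : ∀ Ψ : CMF G c, pair c Ψ ∈ L)
variable (hcover : ∀ Ψ : CMF G c, 2 ≤ bpot c T₀ Ψ → ∃ Q₂ s s' : G, bpot c T₀ Ψ = ddist (rt c Q₂ T₀) Ψ ∧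
    s ∈ (rt c Q₂ T₀).1 \ Ψ.1 ∧ s' ∈ (rt c Q₂ T₀).1 \ Ψ.1 ∧ s ≠ s' ∧
    gface c hc2 Ψ s s' ∈ L ∧
    ((∃ Q₁ t t' : G, bpot c T₀ Ψ = ddist (rt c Q₁ T₀) Ψ ∧ t ∈ (rt c Q₁ T₀).1 \ Ψ.1 ∧ t' ∈ (rt c Q₁ T₀).1 \ Ψ.1 ∧ t ≠ t' ∧
        (∀ Q' : G, ddist (rt c Q' T₀) (oflipCM c hc2 t Ψ) = bpot c T₀ (oflipCM c hc2 t Ψ) → rt c Q' T₀ = rt c Q₁ T₀) ∧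
        (∀ Q' : G, ddist (rt c Q' T₀) (oflipCM c hc2 t' Ψ) = bpot c T₀ (oflipCM c hc2 t' Ψ) → rt c Q' T₀ = rt c Q₁ T₀) ∧
        (∀ Q' : G, ddist (rt c Q' T₀) (oflipCM c hc2 t (oflipCM c hc2 t' Ψ)) = bpot c T₀ (oflipCM c hc2 t (oflipCM c hc2 t' Ψ)) →
          rt c Q' T₀ = rt c Q₁ T₀)) →
      (∀ Q' : G, ddist (rt c Q' T₀) (oflipCM c hc2 s Ψ) = bpot c T₀ (oflipCM c hc2 s Ψ) → rt c Q' T₀ = rt c Q₂ T₀) ∧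
      (∀ Q' : G, ddist (rt c Q' T₀) (oflipCM c hc2 s' Ψ) = bpot c T₀ (oflipCM c hc2 s' Ψ) → rt c Q' T₀ = rt c Q₂ T₀) ∧
      (∀ Q' : G, ddist (rt c Q' T₀) (oflipCM c hc2 s (oflipCM c hc2 s' Ψ)) = bpot c T₀ (oflipCM c hc2 s (oflipCM c hc2 s' Ψ)) →
        rt c Q' T₀ = rt c Q₂ T₀)))

include hc2 hH hQ in
/-- The swap fixes no place: if `s' ∈ T₀` represents the place of `s·Q` (`s ∈ T₀`) then `s ≠ s'` — otherwise `Q ∈ {1, c}` and `T₁ ∈ {T₀, T̄₀}`,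
impossible as `𝓗 ≠ ∅` and (for `s ∈ T₀ ∩ T₁` or `s ∈ 𝓗` alike) `T₁ ≠ T̄₀`. [folklore] -/
theorem ne_rep (hcen : ∀ x : G, x * c = c * x) (hm : 1 ≤ m) (hHc : (T₀.1 ∩ T₁.1).Nonempty) {s s' : G}
    (hss' : s' = s * Q ∨ s' = c * (s * Q)) : s ≠ s' := by
  rintro rfl
  rcases hss' with h | h
  · have hQ1 : Q = 1 := by
      have h' : s * Q = s * 1 := by rw [mul_one]; exact h.symm
      exact mul_left_cancel h'
    rw [hQ1, rt_one] at hQ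
    rw [hQ, Finset.sdiff_self, Finset.card_empty] at hH
    omega
  · have hQc : Q = c := by
      have h3 : s * 1 = s * (c * Q) := by
        calc s * 1 = s := mul_one s
          _ = c * (s * Q) := h
          _ = (c * s) * Q := (mul_assoc _ _ _).symm
          _ = (s * c) * Q := by rw [hcen s]
          _ = s * (c * Q) := mul_assoc _ _ _
      have h4 : c * Q = 1 := (mul_left_cancel h3).symm
      have h5 : c * (c * Q) = c * 1 := by rw [h4]
      rw [← mul_assoc, hc2, one_mul, mul_one] at h5
      exact h5
    rw [hQc] at hQ
    obtain ⟨x, hx⟩ := hHc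
    rw [mem_inter, ← hQ, rt_self_val c hcen] at hx
    exact (mem_sdiff.mp hx.2).2 hx.1

include hc2 hcen hbase hn hH hQ hQQ hσH hLrt hP hcover in
/-- **`2Y_s ∈ L` for every `s ∈ 𝓗`** (`m ≥ 3`; transversals `T ⊆ 𝓗`, `T' ⊆ T₀ ∩ T₁` of size `m`). [folklore] -/
theorem two_smul_Y_mem (hm : 3 ≤ m) (T : Finset G) (hTH : T ⊆ T₀.1 \ T₁.1) (hTm : T.card = m)
    (hT : ∀ t ∈ T₀.1 \ T₁.1, ∀ t' ∈ T₀.1, (t' = t * Q ∨ t' = c * (t * Q)) → (t ∈ T ↔ t' ∉ T))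
    (T' : Finset G) (hTH' : T' ⊆ T₀.1 ∩ T₁.1) (hTm' : T'.card = m)
    (hT' : ∀ t ∈ T₀.1 ∩ T₁.1, ∀ t' ∈ T₀.1, (t' = t * Q ∨ t' = c * (t * Q)) → (t ∈ T' ↔ t' ∉ T')) :
    ∀ s ∈ T₀.1 \ T₁.1, (2 : ℤ) • ((Finsupp.single (oflipCM c hc2 s T₀) (1 : ℤ) - Finsupp.single T₀ 1) +
      (Finsupp.single (oflipCM c hc2 s T₁) (1 : ℤ) - Finsupp.single T₁ 1)) ∈ L := by
  have hHc : (T₀.1 ∩ T₁.1).Nonempty := by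
    obtain ⟨x, hx⟩ := card_pos.mp (by rw [hTm']; omega : 0 < T'.card)
    exact ⟨x, hTH' hx⟩
  -- the difference for any `s ∈ 𝓗` and its image
  have hdiff : ∀ s ∈ T₀.1 \ T₁.1, ∀ s' ∈ T₀.1, (s' = s * Q ∨ s' = c * (s * Q)) →
      (Finsupp.single (oflipCM c hc2 s T₀) (1 : ℤ) + Finsupp.single (oflipCM c hc2 s T₁) 1) -
        (Finsupp.single (oflipCM c hc2 s' T₀) (1 : ℤ) + Finsupp.single (oflipCM c hc2 s' T₁) 1) ∈ L := by
    intro s hs s' hs'0 hss'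
    by_cases hsT : s ∈ T
    · exact Y_sub_Y_mem c hc2 hcen T₀ T₁ hbase m hn hH Q hQ hQQ hσH L hLrt hcover (by omega) T hTH hTm hT hsT hs'0 hss'
    · have hs'T : s' ∈ T := by
        by_contra h; exact hsT ((hT s hs s' hs'0 hss').mpr h)
      have hback : s = s' * Q ∨ s = c * (s' * Q) := rep_rep c hc2 hQQ hss'
      have h := Y_sub_Y_mem c hc2 hcen T₀ T₁ hbase m hn hH Q hQ hQQ hσH L hLrt hcover (by omega) T hTH hTm hT hs'T (mem_sdiff.mp hs).1 hback
      have h' := Submodule.neg_mem _ h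
      rwa [neg_sub] at h'
  intro s hs
  obtain ⟨s', hs'0, hss'⟩ := exists_rep c T₀.2 (s * Q)
  have hne : s ≠ s' := ne_rep c hc2 T₀ T₁ m hH Q hQ hcen (by omega) hHc hss'
  have hsum := Y_add_Y_mem c hc2 hcen T₀ T₁ hbase m hn hH Q hQ hQQ hσH L hLrt hcover hP hm T' hTH' hTm' hT' hs hs'0 hss' hne
  have h := Submodule.add_mem _ hsum (hdiff s hs s' hs'0 hss')
  have e : (2 : ℤ) • ((Finsupp.single (oflipCM c hc2 s T₀) (1 : ℤ) - Finsupp.single T₀ 1) +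
      (Finsupp.single (oflipCM c hc2 s T₁) (1 : ℤ) - Finsupp.single T₁ 1)) =
      ((Finsupp.single (oflipCM c hc2 s T₀) (1 : ℤ) - Finsupp.single T₀ 1) + (Finsupp.single (oflipCM c hc2 s T₁) (1 : ℤ) - Finsupp.single T₁ 1)) +
      ((Finsupp.single (oflipCM c hc2 s' T₀) (1 : ℤ) - Finsupp.single T₀ 1) + (Finsupp.single (oflipCM c hc2 s' T₁) (1 : ℤ) - Finsupp.single T₁ 1)) +
      ((Finsupp.single (oflipCM c hc2 s T₀) (1 : ℤ) + Finsupp.single (oflipCM c hc2 s T₁) 1) -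
        (Finsupp.single (oflipCM c hc2 s' T₀) (1 : ℤ) + Finsupp.single (oflipCM c hc2 s' T₁) 1)) := by module
  rw [e]; exact h

include hc2 hcen hbase hn hH hQ hQQ hσH hLrt hP hcover in
/-- **`2Y'_a ∈ L` for every `a ∈ T₀ ∩ T₁`** (`m ≥ 3`; transversals `T ⊆ 𝓗`, `T' ⊆ T₀ ∩ T₁` of size `m`). [folklore] -/
theorem two_smul_Y'_mem (hm : 3 ≤ m) (T : Finset G) (hTH : T ⊆ T₀.1 \ T₁.1) (hTm : T.card = m)
    (hT : ∀ t ∈ T₀.1 \ T₁.1, ∀ t' ∈ T₀.1, (t' = t * Q ∨ t' = c * (t * Q)) → (t ∈ T ↔ t' ∉ T))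
    (T' : Finset G) (hTH' : T' ⊆ T₀.1 ∩ T₁.1) (hTm' : T'.card = m)
    (hT' : ∀ t ∈ T₀.1 ∩ T₁.1, ∀ t' ∈ T₀.1, (t' = t * Q ∨ t' = c * (t * Q)) → (t ∈ T' ↔ t' ∉ T')) :
    ∀ a ∈ T₀.1 ∩ T₁.1, (2 : ℤ) • ((Finsupp.single (oflipCM c hc2 a T₀) (1 : ℤ) - Finsupp.single T₀ 1) -
      (Finsupp.single (oflipCM c hc2 a T₁) (1 : ℤ) - Finsupp.single T₁ 1)) ∈ L := by
  have hHc : (T₀.1 ∩ T₁.1).Nonempty := by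
    obtain ⟨x, hx⟩ := card_pos.mp (by rw [hTm']; omega : 0 < T'.card)
    exact ⟨x, hTH' hx⟩
  have hdiff : ∀ a ∈ T₀.1 ∩ T₁.1, ∀ a' ∈ T₀.1, (a' = a * Q ∨ a' = c * (a * Q)) →
      (Finsupp.single (oflipCM c hc2 a T₀) (1 : ℤ) - Finsupp.single (oflipCM c hc2 a T₁) 1) -
        (Finsupp.single (oflipCM c hc2 a' T₀) (1 : ℤ) - Finsupp.single (oflipCM c hc2 a' T₁) 1) ∈ L := by
    intro a ha a' ha'0 haa'
    by_cases haT : a ∈ T'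
    · exact Y'_sub_Y'_mem c hc2 hcen T₀ T₁ hbase m hn hH Q hQ hQQ hσH L hLrt hcover hP (by omega) T' hTH' hTm' hT' haT ha'0 haa'
    · have ha'T : a' ∈ T' := by
        by_contra h; exact haT ((hT' a ha a' ha'0 haa').mpr h)
      have hback : a = a' * Q ∨ a = c * (a' * Q) := rep_rep c hc2 hQQ haa'
      have h := Y'_sub_Y'_mem c hc2 hcen T₀ T₁ hbase m hn hH Q hQ hQQ hσH L hLrt hcover hP (by omega) T' hTH' hTm' hT' ha'T
        (mem_inter.mp ha).1 hback
      have h' := Submodule.neg_mem _ h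
      rwa [neg_sub] at h'
  intro a ha
  obtain ⟨a', ha'0, haa'⟩ := exists_rep c T₀.2 (a * Q)
  have hne : a ≠ a' := ne_rep c hc2 T₀ T₁ m hH Q hQ hcen (by omega) hHc haa'
  have hsum := Y'_add_Y'_mem c hc2 hcen T₀ T₁ hbase m hn hH Q hQ hQQ hσH L hLrt hcover hm T hTH hTm hT (mem_inter.mp ha).1
    (mem_inter.mp ha).2 ha'0 haa' hne
  have h := Submodule.add_mem _ hsum (hdiff a ha a' ha'0 haa')
  have e : (2 : ℤ) • ((Finsupp.single (oflipCM c hc2 a T₀) (1 : ℤ) - Finsupp.single T₀ 1) -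
      (Finsupp.single (oflipCM c hc2 a T₁) (1 : ℤ) - Finsupp.single T₁ 1)) =
      ((Finsupp.single (oflipCM c hc2 a T₀) (1 : ℤ) - Finsupp.single T₀ 1) - (Finsupp.single (oflipCM c hc2 a T₁) (1 : ℤ) - Finsupp.single T₁ 1)) +
      ((Finsupp.single (oflipCM c hc2 a' T₀) (1 : ℤ) - Finsupp.single T₀ 1) - (Finsupp.single (oflipCM c hc2 a' T₁) (1 : ℤ) - Finsupp.single T₁ 1)) +
      ((Finsupp.single (oflipCM c hc2 a T₀) (1 : ℤ) - Finsupp.single (oflipCM c hc2 a T₁) 1) -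
        (Finsupp.single (oflipCM c hc2 a' T₀) (1 : ℤ) - Finsupp.single (oflipCM c hc2 a' T₁) 1)) := by module
  rw [e]; exact h

include hc2 hcen hbase hn hH hQ hQQ hσH hLrt hP hcover in
/-- **RESIDUAL CLOSURE from a strict lowering cover** (`m ≥ 3`): every Hodge vector supported on the residual types of `T₀` lies in `L` up to `2`. [folklore] -/
theorem residual_closure_frame (hc1 : c ≠ 1) (hm : 3 ≤ m) (T : Finset G) (hTH : T ⊆ T₀.1 \ T₁.1) (hTm : T.card = m)
    (hT : ∀ t ∈ T₀.1 \ T₁.1, ∀ t' ∈ T₀.1, (t' = t * Q ∨ t' = c * (t * Q)) → (t ∈ T ↔ t' ∉ T))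
    (T' : Finset G) (hTH' : T' ⊆ T₀.1 ∩ T₁.1) (hTm' : T'.card = m)
    (hT' : ∀ t ∈ T₀.1 ∩ T₁.1, ∀ t' ∈ T₀.1, (t' = t * Q ∨ t' = c * (t * Q)) → (t ∈ T' ↔ t' ∉ T')) :
    ∀ y ∈ hodgeSpan c hc2, (∀ Ψ ∈ y.support, bpot c T₀ Ψ ≤ 1) → ((2 : ℤ) ^ 1) • y ∈ L := by
  have hHc : (T₀.1 ∩ T₁.1).card = 2 * m := by
    have h0 := card_sdiff_add_card_inter T₀.1 T₁.1; omega
  have hclose := residual_closure_four c hc2 hc1 hcen T₀ T₁ L hP m hH hHc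
    (two_smul_Y_mem c hc2 hcen T₀ T₁ hbase m hn hH Q hQ hQQ hσH L hLrt hP hcover hm T hTH hTm hT T' hTH' hTm' hT')
    (two_smul_Y'_mem c hc2 hcen T₀ T₁ hbase m hn hH Q hQ hQQ hσH L hLrt hP hcover hm T hTH hTm hT T' hTH' hTm' hT')
    ⟨T, hTH, hTm, rel_transversal_mem c hc2 hcen T₀ T₁ hbase m hn hH Q hQ hQQ hσH L hLrt hcover (by omega) T hTH hTm hT⟩
    ⟨T', hTH', hTm', relc_mem c hc2 hcen T₀ T₁ hbase m hn hH Q hQ hQQ hσH L hLrt hcover hP (by omega) T' hTH' hTm' hT'⟩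
  intro y hy hyR
  refine hclose y hy fun Ψ hΨ => ?_
  rcases residual_cases c T₀ hc2 (hyR Ψ hΨ) with ⟨Q', rfl⟩ | ⟨Q', s, -, rfl⟩
  · rcases hbase Q' with h | h | h | h
    · exact Or.inl h
    · exact Or.inr (Or.inr (Or.inl h))
    · exact Or.inr (Or.inl h)
    · exact Or.inr (Or.inr (Or.inr (Or.inl h)))
  · right; right; right; right
    refine ⟨s * Q'⁻¹, ?_⟩
    rw [rt_oflipCM]
    rcases hbase Q' with h | h | h | h <;> rw [h]
    · exact Or.inl rfl
    · exact Or.inr (Or.inr (Or.inl rfl))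
    · exact Or.inr (Or.inl rfl)
    · exact Or.inr (Or.inr (Or.inr rfl))

end Frame

/-- **THE FOUR-TYPE LAW.**  `G` a finite `2`-group, `c` a central involution `≠ 1`; `T₀`, `T₁` CM types whose base block is `{T₀, T̄₀, T₁, T̄₁}`, with
`|T₀| = 4m`, `m ≥ 3`, `|T₀ ∖ T₁| = 2m`; an involution-like swap `Q` (`T₀·Q⁻¹ = T₁`, `Q² = 1`) whose place permutation preserves `T₀ ∖ T₁`; transversals of
size `m` of that permutation inside `T₀ ∖ T₁` and inside `T₀ ∩ T₁`.  Then **`μ(G, c) = φ₂(G, c)`**: the least number of faces whose base changes together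
with the pairs generate the Hodge lattice is the coinvariant fibre. [folklore] -/
theorem isLeast_card_gfaces_generate_four (hG : IsPGroup 2 G) (hc2 : c * c = 1) (hc1 : c ≠ 1) (hcen : ∀ x : G, x * c = c * x)
    (T₀ T₁ : CMF G c) (hbase : ∀ Q : G, rt c Q T₀ = T₀ ∨ rt c Q T₀ = rt c c T₀ ∨ rt c Q T₀ = T₁ ∨ rt c Q T₀ = rt c c T₁)
    (m : ℕ) (hm : 3 ≤ m) (hn : T₀.1.card = 4 * m) (hH : (T₀.1 \ T₁.1).card = 2 * m)
    (Q : G) (hQ : rt c Q T₀ = T₁) (hQQ : Q * Q = 1)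
    (hσH : ∀ t ∈ T₀.1, ∀ t' ∈ T₀.1, (t' = t * Q ∨ t' = c * (t * Q)) → (t ∈ T₀.1 \ T₁.1 ↔ t' ∈ T₀.1 \ T₁.1))
    (hT : ∃ T : Finset G, T ⊆ T₀.1 \ T₁.1 ∧ T.card = m ∧
      ∀ t ∈ T₀.1 \ T₁.1, ∀ t' ∈ T₀.1, (t' = t * Q ∨ t' = c * (t * Q)) → (t ∈ T ↔ t' ∉ T))
    (hT' : ∃ T' : Finset G, T' ⊆ T₀.1 ∩ T₁.1 ∧ T'.card = m ∧
      ∀ t ∈ T₀.1 ∩ T₁.1, ∀ t' ∈ T₀.1, (t' = t * Q ∨ t' = c * (t * Q)) → (t ∈ T' ↔ t' ∉ T')) :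
    IsLeast {n : ℕ | ∃ S : Finset (CMF G c →₀ ℤ), (↑S ⊆ gfaceSet G c hc2) ∧ S.card = n ∧
      hodgeSpan c hc2 ≤ Submodule.span ℤ (pairSet c) ⊔ Submodule.span ℤ (translates c S)} (fibreTwo c hc2) := by
  obtain ⟨T, hTH, hTm, hTt⟩ := hT
  obtain ⟨T', hTH', hTm', hTt'⟩ := hT'
  refine isLeast_card_gfaces_generate_of_strict_cover_closure c T₀ hG hc2 hc1 hcen 1 fun S hS hlow => ?_
  -- the lattice of the cover: pairs, base-change stability, and the strict lowering property with membership in `L`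
  have hP : ∀ Ψ : CMF G c, pair c Ψ ∈ Submodule.span ℤ (pairSet c) ⊔ Submodule.span ℤ (translates c S) :=
    fun Ψ => Submodule.mem_sup_left (Submodule.subset_span (pair_mem_pairSet c Ψ))
  have hLrt : ∀ (Q' : G) (y : CMF G c →₀ ℤ), y ∈ Submodule.span ℤ (pairSet c) ⊔ Submodule.span ℤ (translates c S) →
      Finsupp.mapDomain (rt c Q') y ∈ Submodule.span ℤ (pairSet c) ⊔ Submodule.span ℤ (translates c S) :=
    fun Q' y hy => mapDomain_rt_mem_psp c hcen Q' S hy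
  exact residual_closure_frame c hc2 hcen T₀ T₁ hbase m hn hH Q hQ hQQ hσH _ hLrt hP
    (fun Ψ h2 => by
      obtain ⟨Q₂, s, s', hQ₂, hs, hs', hss', hmem, hstr⟩ := hlow Ψ h2
      exact ⟨Q₂, s, s', hQ₂, hs, hs', hss', Submodule.mem_sup_right hmem, hstr⟩)
    hc1 hm T hTH hTm hTt T' hTH' hTm' hTt'

end

end Summit.HodgeConjecture.CorCM.Census.CentralSquares
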